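import Literature.Computability.Cryptography.OracleGames
import Literature.Computability.Complexity.Circuit
import HarnessLib

/-!
# PAC learnability of concept classes (Valiant's model) in the H21 oracle framework

Definition request `wi-03892` (route PneNP/Learning). A *concept class* is
`𝒞 : ∀ n, Set ((Fin n → Bool) → Bool)` (the type of `Literature.Computability.MetaComplexity.CombinatorialProperty`);
examples: `sizeClass B s` (functions with a circuit over `B` of size `≤ s n`).

We formalise Valiant's PAC model on top of G01's transcript oracle algorithms
(`Literature.Computability.Complexity.OracleAlg`, coins read from the input as in `OracleAdversary`, INDEXED oracles
`OracleAlg.runIdx` for the randomised example oracle):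

* **The learning game** (`pacSuccessProb`). Parameters `n`, accuracy `ε`, confidence `δ`,
  target `f : (Fin n → Bool) → Bool`, distribution `D : PMF (Fin n → Bool)`, round budget `T`,
  coin budget `c`. Nature draws `T` i.i.d. points `xs ∼ D^T` (`iidList`) and coins
  `r ∼ U({0,1}^c)`; the learner `A : OracleAlg (List Bool)` is run for `T` rounds on input
  `boolPair (pacParams n ⌈1/ε⌉ ⌈1/δ⌉) r` against the oracle `pacOracle mq f xs`, whose answer to
  the `i`-th query is the labelled example `(xsᵢ, f xsᵢ)` (`EX(f, D)`; Kearns–Vazirani, §1.2),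
  except that, when membership queries are enabled (`mq = true`) and the query is `true :: y`
  with `|y| = n`, the answer is `[f y]` (`MQ(f)`; Angluin 1988; Kearns–Vazirani, §8.1). The
  learner's output string is decoded to a hypothesis by a **hypothesis decoder**
  `dec : ∀ n, List Bool → ((Fin n → Bool) → Bool)` (a representation class; total, junk values
  allowed), and the run SUCCEEDS if it halts with output `w` and
  `err_D(dec n w, f) = D{x | dec n w x ≠ f x} ≤ ε` (`errorProb`).
* `IsPACLearnerFor dec 𝒟 mq 𝒞 A coins t`: for all `n`, `f ∈ 𝒞 n`, `D ∈ 𝒟 n`, `ε, δ ∈ (0,1)`,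
  with `T = t n ⌈1/ε⌉ ⌈1/δ⌉` rounds and `coins n ⌈1/ε⌉ ⌈1/δ⌉` coins the success probability is
  `≥ 1 - δ` [Valiant 1984, §§2–3; Kearns–Vazirani 1994, Def. 1 (§1.2.1) with §1.2.2
  (representation size / efficiency)]. `𝒟 = allDistributions` is the distribution-free model,
  `𝒟 = uniformDistributions` the uniform-distribution model.
* `PACLearnableWith dec 𝒟 mq 𝒞 t` (some learner within round budget `t`),
  `PolyPACLearnableWith dec 𝒟 mq 𝒞` (moreover `t`, `coins` polynomially bounded and the step
  function polynomial-time, `OracleAlg.IsPolyTime`), `IsProperFor dec 𝒞` (proper learning: the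
  decoder only produces concepts of `𝒞`).
* **Representation-free variant** `IsPACPredictorFor` / `PolyPACPredictable` (PAC learnability
  with POLYNOMIALLY EVALUATABLE hypotheses; Haussler–Kearns–Littlestone–Warmuth 1991, Pitt–Warmuth
  1990, §2 "polynomial predictability"): the learner `A` outputs an arbitrary string `w` (the
  learned representation) and a second, oracle-free algorithm `E : OracleAlg Bool` (the
  EVALUATOR) predicts `E(w, x)` on a point `x`; the hypothesis is `evalHyp E T₂ w`. The evaluator
  has no oracle, so membership queries cannot be asked about the challenge point (as required in
  prediction-with-membership-queries, Angluin–Kharitonov 1995). This is the form usable today for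
  "learnable by/with polynomial-size circuits" statements, since the tree has no
  `Encoding (Circuit (Fin n)) Bool` yet: a circuit-valued learner yields `(w, E)` with `E` the
  circuit evaluator, and conversely `x ↦ E(w, x)` has polynomial-size circuits.
* WARNING (review of p3132): in `PolyPACLearnableWith dec …` the decoder `dec` is an unrestricted
  parameter; with an arbitrary (non-computable) decoder the notion degenerates to
  information-theoretic learnability and `∃ dec, PolyPACLearnableWith dec …` is trivial.
  Hardness / learnability FACTS must use `PolyPACPredictable` (efficient evaluator built in) or a
  fixed efficient decoder. The concept size `size(c)` of Kearns–Vazirani is folded into `n` via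
  the class (e.g. `sizeClass B s`).

Time is measured, as everywhere in G01, by the number of ROUNDS (step evaluations) plus
`IsPolyTime` of the step function; `ε, δ` enter through `⌈1/ε⌉, ⌈1/δ⌉` in unary
(`pacParams`), so "polynomial in `n, 1/ε, 1/δ`" is polynomial in the input length.

## References

* L. G. Valiant, *A theory of the learnable*, Comm. ACM 27 (1984) 1134–1142, §§2–3.
* M. J. Kearns, U. V. Vazirani, *An Introduction to Computational Learning Theory*, MIT Press
  1994, §1.2 (Def. 1, PAC), §1.2.2 (efficiency, hypothesis size), §8.1 (membership queries).
* A. Blumer, A. Ehrenfeucht, D. Haussler, M. K. Warmuth, *Learnability and the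
  Vapnik–Chervonenkis dimension*, J. ACM 36 (1989) 929–965, §2.
* L. Pitt, M. K. Warmuth, *Prediction-preserving reducibility*, JCSS 41 (1990) 430–467, §2.
* D. Haussler, M. Kearns, N. Littlestone, M. K. Warmuth, *Equivalence of models for polynomial
  learnability*, Inform. and Comput. 95 (1991) 129–161.
* D. Angluin, M. Kharitonov, *When won't membership queries help?*, JCSS 50 (1995) 336–355
  (prediction with membership queries: no queries on the challenge).
-/

noncomputable section

namespace Literature.Computability.Learning

open Complexity _root_.Computability

/-! ### Concept classes -/

/-- A **concept class**: for each input length `n` a set of Boolean functions on `{0,1}ⁿ`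
(same type as `Literature.Computability.MetaComplexity.CombinatorialProperty`). [Kearns–Vazirani 1994, §1.2] [folklore] -/
abbrev ConceptClass : Type := ∀ n : ℕ, Set ((Fin n → Bool) → Bool)

/-- The class of functions computed by a circuit over the basis `B` with at most `s n` gates
(e.g. `sizeClass B2 s` = `SIZE[s]`). [Kearns–Vazirani 1994, §1.2.2; Arora–Barak 2009, Def. 6.5]
[folklore] -/
def sizeClass (B : Set GateFn) (s : ℕ → ℕ) : ConceptClass := fun n =>
  {f | ∃ C : Circuit (Fin n), C.IsOver B ∧ C.Computes f ∧ C.size ≤ s n}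

/-- Membership in `sizeClass`. [folklore] -/
@[simp] theorem mem_sizeClass_iff {B : Set GateFn} {s : ℕ → ℕ} {n : ℕ}
    {f : (Fin n → Bool) → Bool} :
    f ∈ sizeClass B s n ↔ ∃ C : Circuit (Fin n), C.IsOver B ∧ C.Computes f ∧ C.size ≤ s n :=
  Iff.rfl

/-- `sizeClass` is monotone in the size bound. [folklore] -/
theorem sizeClass_mono {B : Set GateFn} {s s' : ℕ → ℕ} (h : ∀ n, s n ≤ s' n) (n : ℕ) :
    sizeClass B s n ⊆ sizeClass B s' n := fun _ ⟨C, hB, hf, hs⟩ => ⟨C, hB, hf, hs.trans (h n)⟩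

/-- A family of admissible distributions, one set per input length. [Kearns–Vazirani 1994, §1.2]
[folklore] -/
abbrev DistributionFamily : Type := ∀ n : ℕ, Set (PMF (Fin n → Bool))

/-- The distribution-free model: every distribution on `{0,1}ⁿ` is admissible.
[Valiant 1984, §2; Kearns–Vazirani 1994, Def. 1] [folklore] -/
def allDistributions : DistributionFamily := fun _ => Set.univ

/-- The uniform-distribution model: only `U({0,1}ⁿ)`. [Kearns–Vazirani 1994, §1.2 (remarks);
Linial–Mansour–Nisan 1993] [folklore] -/
def uniformDistributions : DistributionFamily := fun n => {PMF.uniformOfFintype (Fin n → Bool)}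

/-! ### Error, samples, the example / membership oracle -/

/-- The error of hypothesis `h` against target `f` under `D`: `D {x | h x ≠ f x}` (in `ℝ≥0∞`).
[Valiant 1984, §2; Kearns–Vazirani 1994, Def. 1 (`error(h)`)] [folklore] -/
def errorProb {n : ℕ} (D : PMF (Fin n → Bool)) (h f : (Fin n → Bool) → Bool) : ENNReal :=
  D.toOuterMeasure {x | h x ≠ f x}

/-- The correct hypothesis has error `0`. [folklore] -/
@[simp] theorem errorProb_self {n : ℕ} (D : PMF (Fin n → Bool)) (f : (Fin n → Bool) → Bool) :
    errorProb D f f = 0 := by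
  simp [errorProb]

/-- `k` i.i.d. samples from `D`, as a list. [folklore] -/
def iidList {α : Type*} (D : PMF α) : ℕ → PMF (List α)
  | 0 => PMF.pure []
  | k + 1 => D.bind fun a => (iidList D k).map (a :: ·)

/-- `iidList D 0 = pure []`. [folklore] -/
@[simp] theorem iidList_zero {α : Type*} (D : PMF α) : iidList D 0 = PMF.pure [] := rfl

/-- Lists in the support of `iidList D k` have length `k`. [folklore] -/
theorem length_of_mem_support_iidList {α : Type*} (D : PMF α) :
    ∀ (k : ℕ) {l : List α}, l ∈ (iidList D k).support → l.length = k
  | 0, l, h => by simp [iidList] at h; simp [h]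
  | k + 1, l, h => by
    simp only [iidList, PMF.support_bind, Set.mem_iUnion, PMF.support_map,
      Set.mem_image] at h
    obtain ⟨a, -, l', hl', rfl⟩ := h
    simp [length_of_mem_support_iidList D k hl']

/-- Encoding of a labelled example `(x, b)`: the `n` bits of `x` followed by `b`.
[Kearns–Vazirani 1994, §1.2] [folklore] -/
def encodeExample {n : ℕ} (x : Fin n → Bool) (b : Bool) : List Bool := List.ofFn x ++ [b]

/-- The PAC oracle for target `f` and pre-drawn sample points `xs` (indexed form: the `i`-th
query is answered using `xs[i]`). Example queries (any query when `mq = false`; queries not of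
the form `true :: y` with `|y| = n` when `mq = true`) are answered by the labelled example
`(xsᵢ, f xsᵢ)` (`[]` if `i ≥ |xs|`, which does not happen within `|xs|` rounds); when
`mq = true`, a query `true :: y` with `|y| = n` is a MEMBERSHIP QUERY answered by `[f y]`.
[Kearns–Vazirani 1994, §1.2 (`EX(c, D)`), §8.1 (membership queries); Angluin 1988] [folklore] -/
def pacOracle {n : ℕ} (mq : Bool) (f : (Fin n → Bool) → Bool) (xs : List (Fin n → Bool)) :
    ℕ → List Bool → List Bool := fun i q =>
  match mq, q with
  | true, true :: y =>
    match (encodingBitVec n).decode y with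
    | some x => [f x]
    | none => match xs[i]? with
      | some x => encodeExample x (f x)
      | none => []
  | _, _ => match xs[i]? with
    | some x => encodeExample x (f x)
    | none => []

/-- Without membership queries every query returns the next example. [folklore] -/
@[simp] theorem pacOracle_false {n : ℕ} (f : (Fin n → Bool) → Bool) (xs : List (Fin n → Bool))
    (i : ℕ) (q : List Bool) :
    pacOracle false f xs i q =
      match xs[i]? with | some x => encodeExample x (f x) | none => [] := by
  simp [pacOracle]

/-- With membership queries, `true :: (bits of y)` is answered by `f y`. [folklore] -/
@[simp] theorem pacOracle_true_query {n : ℕ} (f : (Fin n → Bool) → Bool)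
    (xs : List (Fin n → Bool)) (i : ℕ) (y : Fin n → Bool) :
    pacOracle true f xs i (true :: List.ofFn y) = [f y] := by
  have : (encodingBitVec n).decode (List.ofFn y) = some y := (encodingBitVec n).decode_encode y
  simp [pacOracle, this]

/-- The learner's parameter input `⟨1ⁿ, ⟨1ᵃ, 1ᵇ⟩⟩` (`a = ⌈1/ε⌉`, `b = ⌈1/δ⌉` in unary).
[Kearns–Vazirani 1994, §1.2.2] [folklore] -/
def pacParams (n a b : ℕ) : List Bool :=
  boolPair (unaryEncodeNat n) (boolPair (unaryEncodeNat a) (unaryEncodeNat b))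

/-- `⌈1/ε⌉` as a natural number. [folklore] -/
def invCeil (ε : ℝ) : ℕ := ⌈1 / ε⌉₊

/-! ### The PAC game and PAC learnability with a hypothesis decoder -/

/-- **Success probability of one PAC run.** Draw `xs ∼ D^T` and coins `r ∼ U({0,1}^c)`; run `A`
for `T` rounds on `boolPair params r` against `pacOracle mq f xs`; success means the run halts
with an output `w` whose decoded hypothesis has error `≤ ε`.
[Valiant 1984, §2; Kearns–Vazirani 1994, Def. 1] [folklore] -/
def pacSuccessProb {n : ℕ} (dec : List Bool → ((Fin n → Bool) → Bool)) (mq : Bool)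
    (A : OracleAlg (List Bool)) (params : List Bool) (T c : ℕ) (f : (Fin n → Bool) → Bool)
    (D : PMF (Fin n → Bool)) (ε : ℝ) : ENNReal :=
  ((iidList D T).bind fun xs =>
    (PMF.uniformOfFintype (List.Vector Bool c)).map fun r =>
      match A.runIdx (pacOracle mq f xs) T (boolPair params r.toList) with
      | some w => decide (errorProb D (dec w) f ≤ ENNReal.ofReal ε)
      | none => false).toOuterMeasure {true}

/-- **`A` is a PAC learner for `𝒞`** (hypotheses decoded by `dec`, distributions from `𝒟`,
membership queries iff `mq`, `coins n a b` coins and `t n a b` rounds where `a = ⌈1/ε⌉`,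
`b = ⌈1/δ⌉`): for all `n`, `f ∈ 𝒞 n`, `D ∈ 𝒟 n` and `ε, δ ∈ (0,1)` the success probability is at
least `1 - δ`. [Valiant 1984, §§2–3; Kearns–Vazirani 1994, Def. 1 with §1.2.2]
[cite: KearnsVazirani1994, §1.2 Def. 1] -/
def IsPACLearnerFor (dec : ∀ n, List Bool → ((Fin n → Bool) → Bool)) (𝒟 : DistributionFamily)
    (mq : Bool) (𝒞 : ConceptClass) (A : OracleAlg (List Bool)) (coins t : ℕ → ℕ → ℕ → ℕ) :
    Prop :=
  ∀ (n : ℕ) (f : (Fin n → Bool) → Bool), f ∈ 𝒞 n → ∀ D ∈ 𝒟 n, ∀ ε δ : ℝ, 0 < ε → ε < 1 →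
    0 < δ → δ < 1 →
      ENNReal.ofReal (1 - δ) ≤
        pacSuccessProb (dec n) mq A (pacParams n (invCeil ε) (invCeil δ))
          (t n (invCeil ε) (invCeil δ)) (coins n (invCeil ε) (invCeil δ)) f D ε

/-- `𝒞` is PAC learnable (with decoder `dec`, distributions `𝒟`, membership queries iff `mq`)
within round budget `t n ⌈1/ε⌉ ⌈1/δ⌉`. [Valiant 1984, §2; Kearns–Vazirani 1994, Def. 1]
[cite: KearnsVazirani1994, §1.2 Def. 1] -/
def PACLearnableWith (dec : ∀ n, List Bool → ((Fin n → Bool) → Bool)) (𝒟 : DistributionFamily)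
    (mq : Bool) (𝒞 : ConceptClass) (t : ℕ → ℕ → ℕ → ℕ) : Prop :=
  ∃ (A : OracleAlg (List Bool)) (coins : ℕ → ℕ → ℕ → ℕ), IsPACLearnerFor dec 𝒟 mq 𝒞 A coins t

/-- A three-argument budget is polynomially bounded. [folklore] -/
def IsPolyBudget (t : ℕ → ℕ → ℕ → ℕ) : Prop :=
  ∃ p : Polynomial ℕ, ∀ n a b, t n a b ≤ p.eval (n + a + b)

/-- **Efficient (polynomial) PAC learnability**: a learner with polynomial-time step function,
polynomially many coins and rounds, polynomial in `n, 1/ε, 1/δ`.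
[Valiant 1984, §2; Kearns–Vazirani 1994, Def. 1 and §1.2.2] [cite: KearnsVazirani1994, §1.2.2] -/
def PolyPACLearnableWith (dec : ∀ n, List Bool → ((Fin n → Bool) → Bool))
    (𝒟 : DistributionFamily) (mq : Bool) (𝒞 : ConceptClass) : Prop :=
  ∃ (A : OracleAlg (List Bool)) (coins t : ℕ → ℕ → ℕ → ℕ),
    A.IsPolyTime (encodingList Bool) ∧ IsPolyBudget coins ∧ IsPolyBudget t ∧
      IsPACLearnerFor dec 𝒟 mq 𝒞 A coins t

/-- The decoder is PROPER for `𝒞`: every decoded hypothesis is a concept of `𝒞`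
(proper learning = learning with such a decoder). [Kearns–Vazirani 1994, §1.2.2 ("learning `𝒞`
by `𝒞`")] [folklore] -/
def IsProperFor (dec : ∀ n, List Bool → ((Fin n → Bool) → Bool)) (𝒞 : ConceptClass) : Prop :=
  ∀ n w, dec n w ∈ 𝒞 n

/-! ### Representation-free variant: learning with polynomially evaluatable hypotheses -/

/-- The hypothesis defined by an EVALUATOR `E : OracleAlg Bool` and a learned string `w`: on `x`,
run `E` WITHOUT oracle (every query is answered `[]`) for `T₂` rounds on `boolPair w (bits of x)`
and output its bit (`false` if it fails to halt). [Haussler–Kearns–Littlestone–Warmuth 1991, §2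
(polynomially evaluatable hypothesis representations); Pitt–Warmuth 1990, §2] [folklore] -/
def evalHyp {n : ℕ} (E : OracleAlg Bool) (T₂ : ℕ) (w : List Bool) : (Fin n → Bool) → Bool :=
  fun x => (E.run (fun _ => []) T₂ (boolPair w (List.ofFn x))).getD false

/-- **`(A, E)` is a PAC learner with polynomially evaluatable hypotheses for `𝒞`**: the learner
`A : OracleAlg (List Bool)` (examples from `𝒟`, membership queries iff `mq`, budgets `coins`,
`t`) outputs a string `w`, and the hypothesis is `evalHyp E (t₂ n a b) w`; success as in
`IsPACLearnerFor` (indeed this IS `IsPACLearnerFor` with the decoder `w ↦ evalHyp E _ w`).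
[Haussler–Kearns–Littlestone–Warmuth 1991, §2; Pitt–Warmuth 1990, §2; Kearns–Vazirani 1994,
§1.2.2] [cite: PittWarmuth1990, §2] -/
def IsPACPredictorFor (𝒟 : DistributionFamily) (mq : Bool) (𝒞 : ConceptClass)
    (A : OracleAlg (List Bool)) (E : OracleAlg Bool) (coins t t₂ : ℕ → ℕ → ℕ → ℕ) : Prop :=
  ∀ (n : ℕ) (f : (Fin n → Bool) → Bool), f ∈ 𝒞 n → ∀ D ∈ 𝒟 n, ∀ ε δ : ℝ, 0 < ε → ε < 1 →
    0 < δ → δ < 1 →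
      ENNReal.ofReal (1 - δ) ≤
        pacSuccessProb (evalHyp E (t₂ n (invCeil ε) (invCeil δ))) mq A
          (pacParams n (invCeil ε) (invCeil δ)) (t n (invCeil ε) (invCeil δ))
          (coins n (invCeil ε) (invCeil δ)) f D ε

/-- A predictor pair is a PAC learner for the induced decoder. [folklore] -/
theorem IsPACPredictorFor.isPACLearnerFor {𝒟 : DistributionFamily} {mq : Bool} {𝒞 : ConceptClass}
    {A : OracleAlg (List Bool)} {E : OracleAlg Bool} {coins t : ℕ → ℕ → ℕ → ℕ} {T₂ : ℕ → ℕ}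
    (h : IsPACPredictorFor 𝒟 mq 𝒞 A E coins t fun n _ _ => T₂ n) :
    IsPACLearnerFor (fun n => evalHyp E (T₂ n)) 𝒟 mq 𝒞 A coins t := h

/-- **Polynomial PAC learnability with polynomially evaluatable hypotheses** ("polynomial
predictability"): polynomial-time learner AND evaluator step functions, polynomial coin, round and
evaluation budgets in `n + ⌈1/ε⌉ + ⌈1/δ⌉`. Equivalent to polynomial PAC learnability by
polynomial-size circuit hypotheses (HKLW 1991); the tree's rendering of "learnable with
polynomial-size circuit hypotheses". [Haussler–Kearns–Littlestone–Warmuth 1991; Pitt–Warmuth 1990,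
§2] [cite: PittWarmuth1990, §2] -/
def PolyPACPredictable (𝒟 : DistributionFamily) (mq : Bool) (𝒞 : ConceptClass) : Prop :=
  ∃ (A : OracleAlg (List Bool)) (E : OracleAlg Bool) (coins t t₂ : ℕ → ℕ → ℕ → ℕ),
    A.IsPolyTime (encodingList Bool) ∧ E.IsPolyTime encodingBoolBool ∧
      IsPolyBudget coins ∧ IsPolyBudget t ∧ IsPolyBudget t₂ ∧ IsPACPredictorFor 𝒟 mq 𝒞 A E coins t t₂

/-! ### Elementary API -/

/-- Learnability is antitone in the concept class. [folklore] -/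
theorem IsPACLearnerFor.mono {dec : ∀ n, List Bool → ((Fin n → Bool) → Bool)}
    {𝒟 : DistributionFamily} {mq : Bool} {𝒞 𝒞' : ConceptClass} {A : OracleAlg (List Bool)}
    {coins t : ℕ → ℕ → ℕ → ℕ} (h : IsPACLearnerFor dec 𝒟 mq 𝒞 A coins t)
    (h𝒞 : ∀ n, 𝒞' n ⊆ 𝒞 n) : IsPACLearnerFor dec 𝒟 mq 𝒞' A coins t :=
  fun n f hf => h n f (h𝒞 n hf)

/-- Learnability is antitone in the distribution family (distribution-free ⇒ uniform).
[folklore] -/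
theorem IsPACLearnerFor.mono_dist {dec : ∀ n, List Bool → ((Fin n → Bool) → Bool)}
    {𝒟 𝒟' : DistributionFamily} {mq : Bool} {𝒞 : ConceptClass} {A : OracleAlg (List Bool)}
    {coins t : ℕ → ℕ → ℕ → ℕ} (h : IsPACLearnerFor dec 𝒟 mq 𝒞 A coins t)
    (h𝒟 : ∀ n, 𝒟' n ⊆ 𝒟 n) : IsPACLearnerFor dec 𝒟' mq 𝒞 A coins t :=
  fun n f hf D hD => h n f hf D (h𝒟 n hD)

/-- Hence polynomial PAC learnability passes to subclasses and smaller distribution families.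
[folklore] -/
theorem PolyPACLearnableWith.mono {dec : ∀ n, List Bool → ((Fin n → Bool) → Bool)}
    {𝒟 𝒟' : DistributionFamily} {mq : Bool} {𝒞 𝒞' : ConceptClass}
    (h : PolyPACLearnableWith dec 𝒟 mq 𝒞) (h𝒞 : ∀ n, 𝒞' n ⊆ 𝒞 n) (h𝒟 : ∀ n, 𝒟' n ⊆ 𝒟 n) :
    PolyPACLearnableWith dec 𝒟' mq 𝒞' := by
  obtain ⟨A, coins, t, hA, hc, ht, hL⟩ := h
  exact ⟨A, coins, t, hA, hc, ht, (hL.mono h𝒞).mono_dist h𝒟⟩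

/-- Predictability is antitone in the concept class and the distribution family. [folklore] -/
theorem PolyPACPredictable.mono {𝒟 𝒟' : DistributionFamily} {mq : Bool} {𝒞 𝒞' : ConceptClass}
    (h : PolyPACPredictable 𝒟 mq 𝒞) (h𝒞 : ∀ n, 𝒞' n ⊆ 𝒞 n) (h𝒟 : ∀ n, 𝒟' n ⊆ 𝒟 n) :
    PolyPACPredictable 𝒟' mq 𝒞' := by
  obtain ⟨A, E, coins, t, t₂, hA, hE, hc, ht, ht₂, hL⟩ := h
  exact ⟨A, E, coins, t, t₂, hA, hE, hc, ht, ht₂,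
    fun n f hf D hD => hL n f (h𝒞 n hf) D (h𝒟 n hD)⟩

/-- `uniformDistributions ⊆ allDistributions`. [folklore] -/
theorem uniformDistributions_subset (n : ℕ) : uniformDistributions n ⊆ allDistributions n :=
  fun _ _ => trivial

end Literature.Computability.Learning

end
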